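import Literature.MathematicalPhysics.QuantumFieldTheory.Balaban1983to89.HiggsBackgroundRescale

/-!
# `Balaban1983to89.B1Eq38Rescale` — T. Bałaban, *(Higgs)₂,₃ quantum fields in a finite volume. I. A lower bound*,
Commun. Math. Phys. **85** (1982) 603–626 [Balaban1982Higgs1], (3.8)–(3.9) p. 613 and (3.27)–(3.28) p. 617 under the
rescaling, (3.38) p. 619: **the characteristic functions are COVARIANT under the canonical rescaling (1.22)** — the
restrictions `|A(x)| ≤ ℓ^{−(d−2)/2}p`, `|(Δ^ηA)(x)| ≤ ℓ^{−(d+2)/2}p` (and the scalar ones with `Δ^η_A`) written for the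
rescaled fields `σA′`, `σφ′` on the `ε`-family ARE the same restrictions at scale `sℓ` for `A′`, `φ′` on the
`sε`-family (p. 613: *"The restrictions on A, ΔA, φ, Δ_Aφ introduced by χ₀ have now the following form |A(x)|,
|(ΔA)(x)| ≤ p(ε) (3.8), |φ(x)|, |(Δ_Aφ)(x)| ≤ p(ε), x ∈ T₁ (3.9)"* — the case `ℓ = ε`, `s = ε⁻¹`), including the
background fields (3.29) inside `χ_k(A)`, `χ_k(φ)`; whence **the (3.37) integral of the model equals `const ×` the same
integral written entirely on the rescaled lattices** (`integral337_unit`: the (3.38) change of variables with every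
characteristic function identified), PROVED over `HiggsBackgroundRescale` / `HiggsDoubleRTRescale`

statement-level skeleton of published theorems with citation tags; proofs where landed; nothing here is a claim about the Yang–Mills mass gap

PDF held: `paper:balaban1982-cmp85-higgs23-i` (journal page = PDF page + 602).  pp. 607, 613, 617–619 read from the ×2
renders `run/shared/lean/pub/pub-balaban/b2b-balaban-ref1/pages/1982-cmp85-higgs23-I/…-p005/p011/p015/p016/p017-x2.png`.

CITATION HEADER (lean-in-tree rule).  lit-balaban typed skeleton (HOME `run/shared/lean/pub/lit-balaban/`), typer line
(model instances; rows of record unchanged): rows **B1.Eq3.8-3.9** (owner r12: `B1Sect3Statements.SmallFieldUnit`,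
typed), **B1.Eq3.27-3.28** (r12/r14; concrete `B1Eq31Concrete.chiKA/chiKφ`), **B1.Eq3.37-3.38** (r12; the (3.38)
member), **B1.Eq2.20/2.22** (r14; general-field propagator rescaling).  WHAT IS REPRODUCED.  p. 613 [PDF 11], verbatim:
*"This integral is rescaled from the ε-lattice to the unit lattice, i.e. we make the transformations (1.22), (1.23) with
η = ε, δ = 1. … The restrictions on A, ΔA, φ, Δ_Aφ introduced by χ₀ have now the following form |A(x)|, |(ΔA)(x)| ≤ p(ε),
(3.8) |φ(x)|, |(Δ_Aφ)(x)| ≤ p(ε), x ∈ T₁. (3.9)"*; p. 618–619 (3.38) *"… const χ_{k+1}(B)χ_{k+1}(ψ)∫dA∫dφ χ_k(A)χ_k(φ)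
exp[…]"* on the lattices `T_1^{(k)}`, `T_L^{(k+1)}`.  DICTIONARY: `χ` at scale `ℓ`, value `p` = `B1Eq31Concrete.chi0A ℓ p`
(3.1) / `chi0φ C ℓ p` (3.2) / `chiKA`, `chiKφ` (3.27)–(3.28) (thresholds `ℓ^{−(d−2)/2}p`, `ℓ^{−(d+2)/2}p`,
`B1Eq31Concrete.thrF/thrLap`); the rescaling `σ·` = `HiggsRescaling.rescaleScalar/rescaleVec` between the `ε`-family `P`
and the `sε`-family `P.scaleBy s hs`; the rescaled constants `e_s`, `μ₀²s⁻²`, `m²s⁻²` (p. 607).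
PROVED, in this order: (§1) the threshold algebra: `χ({σr ≤ ℓ^{−(d−2)/2}p}) = χ({r ≤ (sℓ)^{−(d−2)/2}p})` and
`χ({s²σr ≤ ℓ^{−(d+2)/2}p}) = χ({r ≤ (sℓ)^{−(d+2)/2}p})` (`chiSmall_rescale`); (§2) the GENERAL-FIELD operator covariance
(complementing the zero-field lemmas of `HiggsBackgroundRescale`): `A(Γ^{(k)})` (`multiContourSum_rescaleVec`), `Q_k(A)`,
`Q_k^*(A)`, `P_k(A)`, `−Δ^{η,N}_{A}` (`covLaplacianN_rescale`: `(−Δ^ε_{σA′})(σφ′) = s²σ(−Δ^{sε}_{A′})φ′` at the charge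
`e_s`), `covOpK_rescale`, **`propagatorK_rescale`** (`G^ε_k(σA′; m²)(σg′) = s⁻²σG^{sε}_k(A′; m²s⁻²)g′`), `bgScalar_rescale`
((3.29) for the scalar field is scale-free); (§3) **`chi0A_rescale`**, **`chi0φ_rescale`** ((3.8)–(3.9): `χ₀^{ℓ}(σA′) =
χ₀^{sℓ}(A′)`, `χ₀^{ℓ}(σA′, σφ′) = χ₀^{sℓ}_{e_s}(A′, φ′)`), **`chiKA_rescale`**, **`chiKφ_rescale`** ((3.27)–(3.28) with the
background fields, masses `μ₀²s⁻²`, `m²s⁻²`), `cutoffDensity_rescale`; (§4) **`integral337_unit`**: the (3.37) integral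
of the (Higgs)₂,₃ model `=` `const(s)` `×` the integral over the `sε`-family fields of
`χ_{k+1}^{sℓ₁}(B′)χ_{k+1}^{sℓ₁}(ψ′)·T_{a,L}[T_{a,L,A^{(k)}}[χ_k^{sℓ₀}(A′)χ_k^{sℓ₀}(φ′)e^{−S(σA′,σφ′)}]](B′,ψ′)` — at
`s = (L^kε)^{−1}`, `ℓ₀ = L^kε`, `ℓ₁ = L^{k+1}ε` these are the unit-lattice `χ_k` and the `L`-lattice `χ_{k+1}` of (3.38).
HONEST SCOPE / NOT HERE: the pulled-back action `S(σ·,σ·)` is not identified with the unit-lattice effective action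
displayed in (3.38) (rows B1.Eq3.30–3.36, absent); positivity `ℓ > 0` of the scales is assumed (true for `L^jε`).
Unit `lit-balaban-typer` gen 3 (literature-prover-lit-balaban-typer-g3-0); HOME/FILED.md records the proposal.
-/

open scoped BigOperators
open _root_.MeasureTheory

namespace Literature.MathematicalPhysics.QuantumFieldTheory.Balaban1983to89.B1Eq38Rescale

open Literature.MathematicalPhysics.QuantumFieldTheory.Balaban1983to89.HiggsLattice
open Literature.MathematicalPhysics.QuantumFieldTheory.Balaban1983to89.HiggsAveraging
open Literature.MathematicalPhysics.QuantumFieldTheory.Balaban1983to89.HiggsCovariance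
open Literature.MathematicalPhysics.QuantumFieldTheory.Balaban1983to89.HiggsCovariancePos
open Literature.MathematicalPhysics.QuantumFieldTheory.Balaban1983to89.HiggsRescaling
open Literature.MathematicalPhysics.QuantumFieldTheory.Balaban1983to89.HiggsDoubleRT
open Literature.MathematicalPhysics.QuantumFieldTheory.Balaban1983to89.HiggsDoubleRTRescale
open Literature.MathematicalPhysics.QuantumFieldTheory.Balaban1983to89.HiggsBackgroundRescale
open Literature.MathematicalPhysics.QuantumFieldTheory.Balaban1983to89.B3MultiscaleFields (toSite zeroCharge)
open Literature.MathematicalPhysics.QuantumFieldTheory.Balaban1983to89.B2Eq21FirstStep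
  (toSite_rescaleVec contourSum_rescaleVec)
open Literature.MathematicalPhysics.QuantumFieldTheory.Balaban1983to89.B1Eq31Concrete
open Literature.MathematicalPhysics.QuantumFieldTheory.Balaban1983to89.B1Ineq337HiggsModel (aSeq_nonneg cutoffDensity)

variable {P : Params} {k N : ℕ} {s : ℝ}

/-! ## 1. The thresholds under the rescaling -/

section Thresholds

/-- `χ({cr ≤ t}) = χ({r ≤ t/c})` for `c > 0`. [cite: Balaban1982Higgs1, (3.8) p.613] -/
theorem ind_mul_left {c : ℝ} (hc : 0 < c) (r t : ℝ) : ind (c * r) t = ind r (t / c) := by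
  have h' : c * r ≤ t ↔ r ≤ t / c := by rw [le_div_iff₀ hc, mul_comm]
  unfold ind
  by_cases h : r ≤ t / c
  · rw [if_pos (h'.mpr h), if_pos h]
  · rw [if_neg (fun h1 => h (h'.mp h1)), if_neg h]

/-- The field threshold: `ℓ^{−(d−2)/2}p / σ = (sℓ)^{−(d−2)/2}p`, `σ = s^{(d−2)/2}` — (3.8): at `ℓ = ε`, `s = ε⁻¹` the
threshold becomes `p(ε)` itself. [cite: Balaban1982Higgs1, (3.8) p.613] -/
theorem thrF_rescale (d : ℕ) {s ℓ : ℝ} (hs : 0 < s) (hℓ : 0 < ℓ) (p : ℝ) :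
    thrF d ℓ p / s ^ (((d : ℝ) - 2) / 2) = thrF d (s * ℓ) p := by
  unfold thrF
  rw [Real.mul_rpow hs.le hℓ.le, Real.rpow_neg hs.le, div_eq_mul_inv]
  ring

/-- The Laplacian threshold: `ℓ^{−(d+2)/2}p / (s²σ) = (sℓ)^{−(d+2)/2}p`. [cite: Balaban1982Higgs1, (3.8) p.613] -/
theorem thrLap_rescale (d : ℕ) {s ℓ : ℝ} (hs : 0 < s) (hℓ : 0 < ℓ) (p : ℝ) :
    thrLap d ℓ p / (s ^ 2 * s ^ (((d : ℝ) - 2) / 2)) = thrLap d (s * ℓ) p := by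
  unfold thrLap
  rw [Real.mul_rpow hs.le hℓ.le]
  have h : s ^ (-(((d : ℝ) + 2) / 2)) = (s ^ 2 * s ^ (((d : ℝ) - 2) / 2))⁻¹ := by
    rw [← Real.rpow_natCast s 2, ← Real.rpow_add hs, ← Real.rpow_neg hs.le]
    congr 1
    push_cast
    ring
  rw [h, div_eq_mul_inv]
  ring

/-- **The characteristic functions are covariant under the rescaling**: for size functions scaling like a field
(`σF′`) and like a Laplacian of a field (`s²σG′`), `χ` at scale `ℓ` equals `χ` at scale `sℓ` of the unscaled sizes
(same value `p`). PROVED. [cite: Balaban1982Higgs1, (3.8)–(3.9) p.613] -/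
theorem chiSmall_rescale {X : Type} [Fintype X] (d : ℕ) {s ℓ : ℝ} (hs : 0 < s) (hℓ : 0 < ℓ) (p : ℝ) (F G : X → ℝ) :
    chiSmall d ℓ p (fun x => s ^ (((d : ℝ) - 2) / 2) * F x) (fun x => s ^ 2 * s ^ (((d : ℝ) - 2) / 2) * G x)
      = chiSmall d (s * ℓ) p F G := by
  have hσ : 0 < s ^ (((d : ℝ) - 2) / 2) := Real.rpow_pos_of_pos hs _
  unfold chiSmall chiProd
  refine Finset.prod_congr rfl fun x _ => ?_
  rw [ind_mul_left hσ, ind_mul_left (mul_pos (pow_pos hs 2) hσ), thrF_rescale d hs hℓ, thrLap_rescale d hs hℓ]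

/-- The norm of a rescaled field at a point: `|σφ′(x)| = σ|φ′(x)|`. [cite: Balaban1982Higgs1, (1.22) p.607] -/
theorem norm_rescaleScalar (hs : 0 < s) (f : ScalarField (P.scaleBy s hs) k N) (x : Site P k) :
    ‖rescaleScalar hs f x‖ = s ^ (((P.d : ℝ) - 2) / 2) * ‖f x‖ := by
  show ‖(s ^ (((P.d : ℝ) - 2) / 2)) • f x‖ = _
  rw [norm_smul, Real.norm_of_nonneg (sigma_pos P hs).le]

end Thresholds

/-! ## 2. The operators at a GENERAL external field under the rescaling -/

section Operators

/-- `A(Γ^{(k)}_{x_k,x})` (2.2) is linear in `A` and the contours are the same labels: `(σA′)(Γ^{(k)}) = σ·A′(Γ^{(k)})`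
(from `B2Eq21FirstStep.contourSum_rescaleVec` and the agreement of the block points, `HiggsBackgroundRescale.blockIter_scaleBy`).
[cite: Balaban1982Higgs1, (2.2) p.608] -/
theorem multiContourSum_rescaleVec (hs : 0 < s) (A' : VecField (P.scaleBy s hs) 0) (k : ℕ) (x : Site P 0) :
    multiContourSum (rescaleVec hs A') k x
      = s ^ (((P.d : ℝ) - 2) / 2) * multiContourSum (P := P.scaleBy s hs) A' k x := by
  unfold multiContourSum
  rw [Finset.mul_sum]
  refine Finset.sum_congr rfl fun j _ => ?_
  rw [contourSum_rescaleVec hs, blockIter_scaleBy (P := P) hs (j + 1) x, blockIter_scaleBy (P := P) hs j x]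
  rfl

/-- **`Q_k(A)` (2.11) under the rescaling**: `Q_k(σA′)(σf′) = σ·Q_k^{e_s}(A′)f′` (the transports through
`HiggsRescaling.U_rescale`). PROVED. [cite: Balaban1982Higgs1, (2.11) p.609] -/
theorem avgQkLin_rescale (hs : 0 < s) (C : ChargeData N) (A' : VecField (P.scaleBy s hs) 0) (k : ℕ)
    (f : ScalarField (P.scaleBy s hs) 0 N) :
    avgQkLin C (rescaleVec hs A') k (rescaleScalar hs f)
      = rescaleScalar hs (avgQkLin (P := P.scaleBy s hs) (C.scaleBy P.d s) A' k f) := by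
  funext y
  rw [avgQkLin_apply, avgQk_apply]
  simp only [rescaleScalar]
  erw [avgQkLin_apply, avgQk_apply]
  simp only [multiContourSum_rescaleVec hs, U_rescale hs C 0, map_smul, ← Finset.smul_sum]
  rw [smul_comm, blockK_scaleBy hs k y]
  rfl

/-- **`Q_k^*(A)` (2.20) under the rescaling**: `Q_k^*(σA′)(σg′) = σ·Q_k^{*,e_s}(A′)g′`. PROVED. [cite: Balaban1982Higgs1, (2.20) p.610] -/
theorem avgQkAdj_rescale (hs : 0 < s) (C : ChargeData N) (A' : VecField (P.scaleBy s hs) 0) (k : ℕ)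
    (g : ScalarField (P.scaleBy s hs) k N) :
    avgQkAdj C (rescaleVec hs A') k (rescaleScalar hs g)
      = rescaleScalar hs (avgQkAdj (P := P.scaleBy s hs) (C.scaleBy P.d s) A' k g) := by
  have happ : ∀ (Q : Params) (C₁ : ChargeData N) (A : VecField Q 0) (h : ScalarField Q k N) (z : Site Q 0),
      avgQkAdj C₁ A k h z = C₁.U (Q.mesh 0) (-(multiContourSum A k z)) (h (blockIter k z)) := by
    intro Q C₁ A h z
    simp [avgQkAdj, ChargeData.star_U]
  funext x
  rw [happ]
  simp only [rescaleScalar]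
  erw [happ]
  rw [multiContourSum_rescaleVec hs, ← mul_neg, U_rescale hs C 0, map_smul, blockIter_scaleBy (P := P) hs k x]

/-- `P_k(A) = Q_k^*(A)Q_k(A)` under the rescaling. [cite: Balaban1982Higgs1, (2.17) p.610] -/
theorem projPk_rescale (hs : 0 < s) (C : ChargeData N) (A' : VecField (P.scaleBy s hs) 0) (k : ℕ)
    (f : ScalarField (P.scaleBy s hs) 0 N) :
    projPk C (rescaleVec hs A') k (rescaleScalar hs f)
      = rescaleScalar hs (projPk (P := P.scaleBy s hs) (C.scaleBy P.d s) A' k f) := by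
  unfold projPk
  rw [LinearMap.comp_apply, LinearMap.comp_apply, avgQkLin_rescale, avgQkAdj_rescale]

/-- **The covariant Laplacian under the rescaling** ((1.23) with p. 607 *"e replaced by e_s"*):
`(−Δ^ε_{σA′})(σφ′) = s²·σ·(−Δ^{sε}_{A′})φ′` at the charge `e_s` (whole torus, any level). PROVED. [cite: Balaban1982Higgs1, (1.23) p.607] -/
theorem covLaplacianN_rescale (hs : 0 < s) (C : ChargeData N) (A' : VecField (P.scaleBy s hs) k)
    (φ' : ScalarField (P.scaleBy s hs) k N) :
    covLaplacianN C Finset.univ (rescaleVec hs A') (rescaleScalar hs φ')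
      = s ^ 2 • rescaleScalar hs (covLaplacianN (P := P.scaleBy s hs) (C.scaleBy P.d s) Finset.univ A' φ') := by
  funext x
  rw [covLaplacianN_univ_apply, Pi.smul_apply]
  simp only [rescaleScalar]
  erw [covLaplacianN_univ_apply]
  simp only [rescaleVec, ← mul_neg, U_rescale hs C k, map_smul, ← smul_sub, ← smul_add, ← Finset.smul_sum, smul_smul,
    mesh_scaleBy]
  have hs0 : s ≠ 0 := hs.ne'
  have hm : P.mesh k ≠ 0 := (P.mesh_pos k).ne'
  have hc : (P.mesh k)⁻¹ ^ 2 * s ^ (((P.d : ℝ) - 2) / 2)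
      = s ^ 2 * (s ^ (((P.d : ℝ) - 2) / 2) * (s * P.mesh k)⁻¹ ^ 2) := by
    field_simp
  rw [hc]
  rfl

/-- **The operator of (2.20) at a general external field under the rescaling**:
`(−Δ^ε_{σA′} + m² + a_k(L^kε)^{−2}P_k(σA′))(σf′) = s²σ·(−Δ^{sε}_{A′} + m²s⁻² + a_k(L^ksε)^{−2}P_k(A′))f′`. PROVED.
[cite: Balaban1982Higgs1, (2.20) p.610] -/
theorem covOpK_rescale (hs : 0 < s) (C : ChargeData N) (A' : VecField (P.scaleBy s hs) 0) (msq a : ℝ) (k : ℕ)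
    (f : ScalarField (P.scaleBy s hs) 0 N) :
    covOpK C Finset.univ (rescaleVec hs A') msq a k (rescaleScalar hs f)
      = s ^ 2 • rescaleScalar hs
          (covOpK (P := P.scaleBy s hs) (C.scaleBy P.d s) Finset.univ A' (msq * s⁻¹ ^ 2) a k f) := by
  unfold covOpK
  simp only [LinearMap.add_apply, LinearMap.smul_apply, LinearMap.id_apply]
  rw [covLaplacianN_rescale hs C A' f, projPk_rescale hs C A' k f, rescaleScalar_add, rescaleScalar_add,
    rescaleScalar_smul, rescaleScalar_smul, smul_add, smul_add, smul_smul, smul_smul, mesh_scaleBy, aSeq_scaleBy]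
  have hs0 : s ≠ 0 := hs.ne'
  have hm : P.mesh k ≠ 0 := (P.mesh_pos k).ne'
  have h1 : s ^ 2 * (msq * s⁻¹ ^ 2) = msq := by field_simp
  have h2 : s ^ 2 * (B1.aSeq a P.L k * (s * P.mesh k)⁻¹ ^ 2) = B1.aSeq a P.L k * (P.mesh k)⁻¹ ^ 2 := by
    field_simp
  rw [h1, h2]

/-- **The propagator `G^ε_k(Ω, A)` (2.20) under the rescaling** (p. 610, (2.22)), general external field:
`G^ε_k(σA′; m²)(σg′) = s⁻²·σ·G^{sε}_k(A′; m²s⁻²)g′` for `m² > 0`, `a_k ≥ 0`. PROVED (from `G(−Δ+…) = 1` on both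
lattices, `HiggsCovariancePos`). [cite: Balaban1982Higgs1, (2.22) p.610] -/
theorem propagatorK_rescale (hs : 0 < s) (C : ChargeData N) (A' : VecField (P.scaleBy s hs) 0) {msq : ℝ}
    (hmsq : 0 < msq) (a : ℝ) (k : ℕ) (hak : 0 ≤ B1.aSeq a P.L k) (g : ScalarField (P.scaleBy s hs) 0 N) :
    propagatorK C Finset.univ (rescaleVec hs A') msq a k (rescaleScalar hs g)
      = s⁻¹ ^ 2 • rescaleScalar hs
          (propagatorK (P := P.scaleBy s hs) (C.scaleBy P.d s) Finset.univ A' (msq * s⁻¹ ^ 2) a k g) := by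
  have hmsq' : 0 < msq * s⁻¹ ^ 2 := mul_pos hmsq (pow_pos (inv_pos.mpr hs) 2)
  set h := propagatorK (P := P.scaleBy s hs) (C.scaleBy P.d s) Finset.univ A' (msq * s⁻¹ ^ 2) a k g with hh
  have hg : g = covOpK (P := P.scaleBy s hs) (C.scaleBy P.d s) Finset.univ A' (msq * s⁻¹ ^ 2) a k h :=
    (covOpK_propagatorK_apply (P := P.scaleBy s hs) (C.scaleBy P.d s) Finset.univ A' hmsq' a k hak g).symm
  have hR : rescaleScalar hs g
      = s⁻¹ ^ 2 • covOpK C Finset.univ (rescaleVec hs A') msq a k (rescaleScalar hs h) := by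
    rw [covOpK_rescale hs C A' msq a k h, ← hg, smul_smul]
    have hs0 : s ≠ 0 := hs.ne'
    rw [show s⁻¹ ^ 2 * s ^ 2 = 1 by field_simp, one_smul]
  rw [hR, map_smul, propagatorK_covOpK_apply C Finset.univ _ hmsq a k hak]

/-- **(3.29) for the scalar field is scale-free**: `a_k(L^kε)^{−2}G^ε_k(σÃ′)Q_k^*(σÃ′)(σφ′) =
σ·a_k(L^ksε)^{−2}G^{sε}_k(Ã′; m²s⁻²)Q_k^*(Ã′)φ′` (general external field `Ã`, charge `e_s`). PROVED. [cite: Balaban1982Higgs1, (3.29) p.617] -/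
theorem bgScalar_rescale (hs : 0 < s) (C : ChargeData N) {msq : ℝ} (hmsq : 0 < msq) {a : ℝ} (k : ℕ)
    (hak : 0 ≤ B1.aSeq a P.L k) (A' : VecField (P.scaleBy s hs) 0) (φ' : ScalarField (P.scaleBy s hs) k N) :
    bgScalar C msq a k (rescaleVec hs A') (rescaleScalar hs φ')
      = rescaleScalar hs (bgScalar (P := P.scaleBy s hs) (C.scaleBy P.d s) (msq * s⁻¹ ^ 2) a k A' φ') := by
  rw [bgScalar_eq, bgScalar_eq, avgQkAdj_rescale hs C A' k φ', propagatorK_rescale hs C A' hmsq a k hak, smul_smul]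
  funext x
  simp only [Pi.smul_apply, rescaleScalar, mesh_scaleBy, aSeq_scaleBy]
  have hs0 : s ≠ 0 := hs.ne'
  have hm : P.mesh k ≠ 0 := (P.mesh_pos k).ne'
  have hc : B1.aSeq a P.L k * (P.mesh k ^ 2)⁻¹ * s⁻¹ ^ 2 = B1.aSeq a P.L k * ((s * P.mesh k) ^ 2)⁻¹ := by
    field_simp
  rw [smul_comm, hc]

end Operators

/-! ## 3. (3.8)–(3.9), (3.27)–(3.28): the characteristic functions under the rescaling -/

section Chi

/-- **(3.8) p. 613 — `χ₀(A)` (3.1) is covariant**: `χ₀^{ℓ,p}(σA′) = χ₀^{sℓ,p}(A′)` (the restrictions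
`|σA′(x)| ≤ ℓ^{−(d−2)/2}p`, `|(Δ^ε σA′)(x)| ≤ ℓ^{−(d+2)/2}p` are `|A′(x)| ≤ (sℓ)^{−(d−2)/2}p`, `|(Δ^{sε}A′)(x)| ≤
(sℓ)^{−(d+2)/2}p`; at `ℓ = ε`, `s = ε⁻¹`: `≤ p(ε)` on `T₁`). PROVED. [cite: Balaban1982Higgs1, (3.8) p.613] -/
theorem chi0A_rescale (hs : 0 < s) {ℓ : ℝ} (hℓ : 0 < ℓ) (p : ℝ) (A' : VecField (P.scaleBy s hs) k) :
    chi0A ℓ p (rescaleVec hs A') = chi0A (P := P.scaleBy s hs) (s * ℓ) p A' := by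
  have hF : (fun x : Site P k => ‖toSite (rescaleVec hs A') x‖)
      = fun x => s ^ (((P.d : ℝ) - 2) / 2) * ‖toSite (P := P.scaleBy s hs) A' x‖ := by
    funext x
    rw [toSite_rescaleVec hs A', norm_rescaleScalar]
    rfl
  have hG : (fun x : Site P k => ‖negLap (toSite (rescaleVec hs A')) x‖)
      = fun x => s ^ 2 * s ^ (((P.d : ℝ) - 2) / 2)
          * ‖covLaplacianN (P := P.scaleBy s hs) (zeroCharge (P.scaleBy s hs).d) Finset.univ 0
              (toSite (P := P.scaleBy s hs) A') x‖ := by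
    funext x
    rw [toSite_rescaleVec hs A']
    unfold negLap
    rw [covLaplacianN_zero_rescale hs _ (zeroCharge P.d) (zeroCharge (P.scaleBy s hs).d), Pi.smul_apply, norm_smul,
      norm_rescaleScalar, Real.norm_of_nonneg (pow_nonneg hs.le 2), mul_assoc]
    rfl
  unfold chi0A
  rw [hF, hG]
  exact (chiSmall_rescale P.d hs hℓ p (fun x : Site P k => ‖toSite (P := P.scaleBy s hs) A' x‖)
    (fun x : Site P k => ‖covLaplacianN (P := P.scaleBy s hs) (zeroCharge (P.scaleBy s hs).d) Finset.univ 0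
      (toSite (P := P.scaleBy s hs) A') x‖)).trans rfl

/-- **(3.9) p. 613 — `χ₀(φ)` (3.2) is covariant**: `χ₀^{ℓ,p}(σA′, σφ′) = χ₀^{sℓ,p}_{e_s}(A′, φ′)` (the covariant
Laplacian `Δ^ε_{σA′}(σφ′) = s²σΔ^{sε}_{A′}φ′` at the rescaled charge). PROVED. [cite: Balaban1982Higgs1, (3.9) p.613] -/
theorem chi0φ_rescale (hs : 0 < s) {ℓ : ℝ} (hℓ : 0 < ℓ) (C : ChargeData N) (p : ℝ) (A' : VecField (P.scaleBy s hs) k)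
    (φ' : ScalarField (P.scaleBy s hs) k N) :
    chi0φ C ℓ p (rescaleVec hs A') (rescaleScalar hs φ')
      = chi0φ (P := P.scaleBy s hs) (C.scaleBy P.d s) (s * ℓ) p A' φ' := by
  have hF : (fun x : Site P k => ‖rescaleScalar hs φ' x‖) = fun x => s ^ (((P.d : ℝ) - 2) / 2) * ‖φ' x‖ := by
    funext x
    rw [norm_rescaleScalar]
  have hG : (fun x : Site P k => ‖covLaplacianN C Finset.univ (rescaleVec hs A') (rescaleScalar hs φ') x‖)
      = fun x => s ^ 2 * s ^ (((P.d : ℝ) - 2) / 2)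
          * ‖covLaplacianN (P := P.scaleBy s hs) (C.scaleBy P.d s) Finset.univ A' φ' x‖ := by
    funext x
    rw [covLaplacianN_rescale hs C A' φ', Pi.smul_apply, norm_smul, norm_rescaleScalar,
      Real.norm_of_nonneg (pow_nonneg hs.le 2), mul_assoc]
  unfold chi0φ
  rw [hF, hG]
  exact (chiSmall_rescale P.d hs hℓ p (fun x : Site P k => ‖φ' x‖)
    (fun x : Site P k => ‖covLaplacianN (P := P.scaleBy s hs) (C.scaleBy P.d s) Finset.univ A' φ' x‖)).trans rfl

/-- **(3.27) with its background field (3.29) is covariant**: `χ_k^{ℓ,p}(σA′) = χ_k^{sℓ,p}(A′)` with the vector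
mass `μ₀²` replaced by `μ₀²s⁻²` (p. 607) — `A^{(k),ε}[σA′] = σA^{(k),sε}[A′]`, `HiggsBackgroundRescale.bgVec_rescale`,
then (3.8). PROVED. [cite: Balaban1982Higgs1, (3.27) p.617] -/
theorem chiKA_rescale (hs : 0 < s) {ℓ : ℝ} (hℓ : 0 < ℓ) (p : ℝ) {mu0sq a : ℝ} (hmu : 0 < mu0sq) (ha : 0 ≤ a)
    (k : ℕ) (A' : VecField (P.scaleBy s hs) k) :
    chiKA ℓ p mu0sq a k (rescaleVec hs A') = chiKA (P := P.scaleBy s hs) (s * ℓ) p (mu0sq * s⁻¹ ^ 2) a k A' := by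
  unfold chiKA
  rw [bgVec_rescale hs hmu ha k A', chi0A_rescale hs hℓ]

/-- **(3.28) with its background fields (3.29) is covariant**: `χ_k^{ℓ,p}(σA′, σφ′) = χ_k^{sℓ,p}_{e_s}(A′, φ′)` with
`μ₀² ↦ μ₀²s⁻²`, `m² ↦ m²s⁻²`. PROVED. [cite: Balaban1982Higgs1, (3.28) p.617] -/
theorem chiKφ_rescale (hs : 0 < s) {ℓ : ℝ} (hℓ : 0 < ℓ) (C : ChargeData N) (p : ℝ) {mu0sq msq a : ℝ}
    (hmu : 0 < mu0sq) (hmsq : 0 < msq) (ha : 0 ≤ a) (k : ℕ) (A' : VecField (P.scaleBy s hs) k)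
    (φ' : ScalarField (P.scaleBy s hs) k N) :
    chiKφ C ℓ p mu0sq msq a k (rescaleVec hs A') (rescaleScalar hs φ')
      = chiKφ (P := P.scaleBy s hs) (C.scaleBy P.d s) (s * ℓ) p (mu0sq * s⁻¹ ^ 2) (msq * s⁻¹ ^ 2) a k A' φ' := by
  unfold chiKφ
  rw [bgVec_rescale hs hmu ha k A', bgScalar_rescale hs C hmsq k (aSeq_nonneg ha k) _ φ', chi0φ_rescale hs hℓ]

/-- The (3.26)/(3.37) integrand under the rescaling: `χ_k(σA′)χ_k(σA′,σφ′)e^{−S(σA′,σφ′)}` is the cut-off density of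
the `sε`-family at scale `sℓ`, rescaled masses and charge, for the pulled-back action. [cite: Balaban1982Higgs1, (3.38) p.619] -/
theorem cutoffDensity_rescale (hs : 0 < s) {ℓ : ℝ} (hℓ : 0 < ℓ) (C : ChargeData N) (p : ℝ) {mu0sq msq a : ℝ}
    (hmu : 0 < mu0sq) (hmsq : 0 < msq) (ha : 0 ≤ a) (k : ℕ) (S : VecField P k → ScalarField P k N → ℝ)
    (A' : VecField (P.scaleBy s hs) k) (φ' : ScalarField (P.scaleBy s hs) k N) :
    cutoffDensity C ℓ p mu0sq msq a k S (rescaleVec hs A') (rescaleScalar hs φ')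
      = cutoffDensity (P := P.scaleBy s hs) (C.scaleBy P.d s) (s * ℓ) p (mu0sq * s⁻¹ ^ 2) (msq * s⁻¹ ^ 2) a k
          (fun A'' φ'' => S (rescaleVec hs A'') (rescaleScalar hs φ'')) A' φ' := by
  unfold cutoffDensity
  rw [chiKA_rescale hs hℓ p hmu ha, chiKφ_rescale hs hℓ C p hmu hmsq ha]

end Chi

/-! ## 4. (3.38): the (3.37) integral written on the rescaled lattices -/

section Unit

/-- **(3.37) → (3.38) p. 618–619 for the (Higgs)₂,₃ model, every characteristic function identified**: for `s > 0`,
scales `ℓ₀, ℓ₁ > 0`, `μ₀², m² > 0`, `a ≥ 0` and any `S`,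
`∫dB∫dψ χ^{ℓ₁}_{k+1}(B)χ^{ℓ₁}_{k+1}(ψ) T^{L^kε}_{a,L}[T^{L^kε}_{a,L,A^{(k),ε}}[χ^{ℓ₀}_k(A)χ^{ℓ₀}_k(φ)e^{−S}]](B, ψ)
 = const(s) · ∫dB′∫dψ′ χ^{sℓ₁}_{k+1}(B′)χ^{sℓ₁}_{k+1}(ψ′) T_{a,L}[T_{a,L,A^{(k)}}[χ^{sℓ₀}_k(A′)χ^{sℓ₀}_k(φ′)e^{−S(σA′,σφ′)}]](B′, ψ′)`
on the `sε`-family with charge `e_s` and masses `μ₀²s⁻²`, `m²s⁻²` — at `s = (L^kε)^{−1}`, `ℓ₀ = L^kε`, `ℓ₁ = L^{k+1}ε`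
the right side carries the unit-lattice `χ_k` and the `L`-lattice `χ_{k+1}` displayed in (3.38); `const(s) =
σ^{|bonds of T^{(k+1)}| + N|T^{(k+1)}|}·rescaleFactor`. PROVED (`HiggsBackgroundRescale.integral337_rescale` + §3).
The pulled-back action is NOT rewritten as the unit-lattice effective action of (3.38). [cite: Balaban1982Higgs1, (3.38) p.619] -/
theorem integral337_unit (hs : 0 < s) (C : ChargeData N) {mu0sq msq a : ℝ} (hmu : 0 < mu0sq) (hmsq : 0 < msq)
    (ha : 0 ≤ a) (k : ℕ) (S : VecField P k → ScalarField P k N → ℝ) {ℓ₀ ℓ₁ : ℝ} (hℓ₀ : 0 < ℓ₀) (hℓ₁ : 0 < ℓ₁)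
    (p₀ p₁ : ℝ) :
    ∫ Ψ : VecField P (k + 1) × ScalarField P (k + 1) N,
        chiKA ℓ₁ p₁ mu0sq a (k + 1) Ψ.1 * chiKφ C ℓ₁ p₁ mu0sq msq a (k + 1) Ψ.1 Ψ.2
          * doubleRTk C a (fun A : VecField P k => bgVec mu0sq a k A) (cutoffDensity C ℓ₀ p₀ mu0sq msq a k S) Ψ.1 Ψ.2
      = (s ^ (((P.d : ℝ) - 2) / 2)) ^ (Fintype.card (PBond P (k + 1)) + N * Fintype.card (Site P (k + 1)))
          * rescaleFactor P N k s
          * ∫ Ψ' : VecField (P.scaleBy s hs) (k + 1) × ScalarField (P.scaleBy s hs) (k + 1) N,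
              chiKA (P := P.scaleBy s hs) (s * ℓ₁) p₁ (mu0sq * s⁻¹ ^ 2) a (k + 1) Ψ'.1
                  * chiKφ (P := P.scaleBy s hs) (C.scaleBy P.d s) (s * ℓ₁) p₁ (mu0sq * s⁻¹ ^ 2) (msq * s⁻¹ ^ 2) a
                      (k + 1) Ψ'.1 Ψ'.2
                * doubleRTk (P := P.scaleBy s hs) (C.scaleBy P.d s) a
                    (fun A' : VecField (P.scaleBy s hs) k => bgVec (mu0sq * s⁻¹ ^ 2) a k A')
                    (cutoffDensity (P := P.scaleBy s hs) (C.scaleBy P.d s) (s * ℓ₀) p₀ (mu0sq * s⁻¹ ^ 2)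
                      (msq * s⁻¹ ^ 2) a k (fun A'' φ'' => S (rescaleVec hs A'') (rescaleScalar hs φ'')))
                    Ψ'.1 Ψ'.2 := by
  have hρ : (fun (A' : VecField (P.scaleBy s hs) k) (φ' : ScalarField (P.scaleBy s hs) k N) =>
        cutoffDensity C ℓ₀ p₀ mu0sq msq a k S (rescaleVec hs A') (rescaleScalar hs φ'))
      = cutoffDensity (P := P.scaleBy s hs) (C.scaleBy P.d s) (s * ℓ₀) p₀ (mu0sq * s⁻¹ ^ 2) (msq * s⁻¹ ^ 2) a k
          (fun A'' φ'' => S (rescaleVec hs A'') (rescaleScalar hs φ'')) := by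
    funext A' φ'
    exact cutoffDensity_rescale hs hℓ₀ C p₀ hmu hmsq ha k S A' φ'
  rw [integral337_rescale hs C hmu ha msq k S ℓ₀ p₀ ℓ₁ p₁, hρ]
  simp_rw [chiKA_rescale hs hℓ₁ p₁ hmu ha (k + 1), chiKφ_rescale hs hℓ₁ C p₁ hmu hmsq ha (k + 1)]

end Unit

end Literature.MathematicalPhysics.QuantumFieldTheory.Balaban1983to89.B1Eq38Rescale
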